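import Literature.MathematicalPhysics.QuantumFieldTheory.Balaban1983to89.B9Thm311CubeLettersGCoercive

/-!
# `Balaban1983to89.B9Eq382CubeLetters` — [B9] (3.82) p. 407 AT r05's CUBE LETTERS: the remainder `V(A) = Δ_{a,□}(U₀) − Δ_{a,□}(U′)` SPLIT BY LETTER
# into its Laplacian, projection and averaging pieces (with print's regroupings (3.74)–(3.76) «(D′ − D)R D* + D(R′ − R)D* + …» and (3.82)
# «F₂*aQ + Q*aF₂ + F₂*aF₂»), and the first-order relative bound (ii) of `B9Thm311CubeLettersGCoercive` COMPOSED from per-piece `L²` bounds —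
# whence Theorem 3.11 ∕ (3.84)–(3.86) for the cube letters from three displayed piece sizes

statement-level skeleton of published theorems with citation tags; proofs where landed; nothing here is a claim about the Yang–Mills mass gap

T. Bałaban, *Propagators for lattice gauge theories in a background field*, Commun. Math. Phys. **99** (1985) 389–434 [`Balaban1985BackgroundPropagators`,
"[B9]"; held text `paper:balaban1985-cmp99-background-propagators`, journal page = PDF page + 388; pp. 404–407 read first-hand on `p0016.txt`–`p0019.txt`].

THE PRINT (verbatim, p. 407): «Combining the expansions (3.71), (3.76) and (3.80) we get Δ_a(U′U) = D*_{U′U}D_{U′U} + Δ′(U′U) + D_{U′U}R(U′U)D*_{U′U} +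
Q*(U′U)aQ(U′U) = Δ_a(U) − V₁(A) + (Δ′(U′U) − Δ′(U)) − V₂(A) − P₁(A) + F₂*(A)aQ(U) + Q*(U)aF₂(A) + F₂*(A)aF₂(A) = Δ_a(U) − V₃(A) − P₁(A) − P₂(A). (3.82)
The operator V₃(A) is a local differential operator of the first order satisfying the bound (3.73). The operator P₁(A) was defined in (3.76). It is a
non-local bounded operator and satisfies the bound (3.77). The operator P₂(A) is a sum of three terms obtained by the expansion of averaging operators. …
Let us denote the sum of these three operators by V(A).»; p. 405 (3.76): «D_{U′U}R(U′U)D*_{U′U} = DRD* − V₂(A) − P₁(A)»; p. 406–407 (3.80): «Q(U′U) =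
Q(U) + F₂(A), Q*(U′U) = Q*(U) + F₂*(A)».

WHY THIS FILE.  `B9Thm311CubeLettersGCoercive` (✓ p620365, this seat) turns Theorem 3.11 ∕ (3.84)–(3.86) for r05's cube letters into two displayed
inputs, (i) a flat coercivity and (ii) ONE first-order relative bound of the whole remainder `V(A)`.  Print supplies (ii) PIECEWISE — V₃ (first order,
(3.73)), P₁ (bounded, (3.77)), P₂ (bounded, (3.83)) — and r05's cube letter `deltaACubeY = hessY + gradY∘R_□∘divY + Qs_□∘a_□∘Q_□`
(`B9CubeLettersBondOpsL0` :156) splits `V(A)` by letter accordingly.  THIS FILE (a) proves the split and print's two regroupings as operator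
identities (pure algebra), (b) gives the `L²` composition calculus in the trace currency (pieces with sizes `(a_k, b_k)` ⇒ (ii) with `(Σa_k, Σb_k)`;
zeroth-order products of bounded letters), and (c) restates p620365's conclusions with (ii) replaced by the three piece bounds — so the three suppliers
(Laplacian piece: first order, [B9] (3.70)–(3.73); projection piece: (3.74)–(3.77), Thm 3.1∕3.2 machinery; averaging piece: (3.80)–(3.83), cell
`lit-balaban` slot M5.1b-Q) can land independently.  Nothing of [B9]'s analysis is asserted: every size is a displayed hypothesis.

WHAT IS PROVED (sorry-free; 0 `def`).
* §1 ALGEBRA: `comp3_sub_comp3` ∕ `comp3_sub_comp3'` (generic telescopings), ★ `deltaACubeY_sub_split` (V = V_Δ + V_R + V_Q at the cube letters, any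
  transporters, any `U₀`, `U′`), `gradRdiv_sub_regroup` ((3.74)–(3.76) shape), `QsaQ_sub_regroup` ((3.82) shape with the LETTERS `F₂ := Q_□(U′) − Q_□(U₀)`,
  `F₂* := Qs_□(U′) − Qs_□(U₀)`; no (3.80) content).
* §2 `L²` COMPOSITION (trace currency, any finite carriers and weights): `normBound_comp` (products of bounded letters), `normBound_comp_firstOrder`,
  `trIP_neg_neg`, `sqrt_trIP_add3_self_le`; §2b THE (3.85) MECHANISM PROPER: ★★ `trIP_comp_rightInv_le_of_relBoundN` ∕ `…_lt_self_…` — relative bound against an ARBITRARY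
  functional `𝒩` plus the mapping property `𝒩(G₀B) ≦ ν‖B‖` of the base inverse («assuming that Theorem 3.3 holds for G(U)») ⇒ `⟨B, R(G₀B)⟩ ≦ (a∕m + bν)⟨B,B⟩`.
* §3 AT THE CUBE LETTERS: ★★ `relBound_V_of_pieces` ((ii) from three piece bounds), `hQ_of_normBound_reversed` (hand-over shape for r05's
  `B9Eq383CubeLetters` §4: a plain `L²` bound of print's `P₂`-difference written `U′`-first feeds `hQ` with `(a₃, b₃) = (a_P, 0)`), ★★★ `deltaACubeY_posDefTr_of_pieces` (Theorem 3.11 ∕ the `L²` size of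
  `G_□(U′)` from (i) + three piece bounds, `θ = Σa_k∕m + Σb_k∕√m < 1`), ★★ `hV_of_pieces` (r05's `hV` likewise), ★★★ `hV_of_relBoundN` (r05's `hV` by print's own
  mechanism: flat coercivity + `𝒩`-relative bound of `V(A)` + `𝒩(G_□(1)B) ≦ ν‖B‖`, the [4] mapping property of the flat cube inverse, displayed).

HONEST SCOPE.  Operator algebra and Cauchy–Schwarz bookkeeping; the piece sizes are displayed hypotheses of printed shape, NOT proved; `L²` only; count-
neutral; NOT a node discharge; no summit or sub-problem statement is proved or implied (rungs R3∕R4 conditional; nothing continuum ∕ OS ∕ mass gap; not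
Clay).  No `sorry`∕`axiom`∕`instance`∕`notation`; NEW file, modifies nothing.  Seat `ym-inputs-p02` (prover-ym-inputs-p02-0), cell `pub/ym-inputs`, 2026-08-28.
-/

namespace Literature.MathematicalPhysics.QuantumFieldTheory.Balaban1983to89.B9Eq382CubeLetters

open B9Thm311ReadingCoords B9Thm311DeltaPrimePos B9Thm31SiteGpBoundsReg335Y Node00 B9CubeLettersBondOpsL0
  B9CubeLettersBondOpsAtOneIdentL0 B9Thm311CubeLettersG B9Thm311CubeLettersGCoercive
open Literature.MathematicalPhysics.QuantumFieldTheory.Balaban1983to89.B6KLevelCensusIndexV1 (KIdx)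
open Literature.MathematicalPhysics.QuantumFieldTheory.Balaban1983to89.B6Cover236MultiLevelBlocks (cubes)
open scoped Matrix

noncomputable section

/-! ## §1 The split of `V(A)` by letter, and print's regroupings -/

section Algebra

variable {K : Type*} [CommRing K] {M₁ M₂ M₃ M₄ : Type*} [AddCommGroup M₁] [Module K M₁] [AddCommGroup M₂] [Module K M₂]
  [AddCommGroup M₃] [Module K M₃] [AddCommGroup M₄] [Module K M₄]

/-- the telescoping behind (3.74)–(3.76): `D₀R₀E₀ − D′R′E′ = (D₀ − D′)R₀E₀ + D′(R₀ − R′)E₀ + D′R′(E₀ − E′)`.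
[cite: Balaban1985BackgroundPropagators, (3.74)–(3.76) p.405; bookkeeping] -/
theorem comp3_sub_comp3 (D₀ D' : M₃ →ₗ[K] M₄) (R₀ R' : M₂ →ₗ[K] M₃) (E₀ E' : M₁ →ₗ[K] M₂) :
    D₀ ∘ₗ R₀ ∘ₗ E₀ - D' ∘ₗ R' ∘ₗ E' = (D₀ - D') ∘ₗ R₀ ∘ₗ E₀ + D' ∘ₗ (R₀ - R') ∘ₗ E₀ + D' ∘ₗ R' ∘ₗ (E₀ - E') := by
  simp only [LinearMap.sub_comp, LinearMap.comp_sub]; abel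

/-- the telescoping behind (3.82)'s averaging terms: `S′aQ′ − S₀aQ₀ = (S′ − S₀)aQ₀ + S₀a(Q′ − Q₀) + (S′ − S₀)a(Q′ − Q₀)`.
[cite: Balaban1985BackgroundPropagators, (3.80)–(3.82) pp.406–407; bookkeeping] -/
theorem comp3_sub_comp3' (S₀ S' : M₃ →ₗ[K] M₄) (a : M₂ →ₗ[K] M₃) (Q₀ Q' : M₁ →ₗ[K] M₂) :
    S' ∘ₗ a ∘ₗ Q' - S₀ ∘ₗ a ∘ₗ Q₀ = (S' - S₀) ∘ₗ a ∘ₗ Q₀ + S₀ ∘ₗ a ∘ₗ (Q' - Q₀) + (S' - S₀) ∘ₗ a ∘ₗ (Q' - Q₀) := by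
  simp only [LinearMap.sub_comp, LinearMap.comp_sub]; abel

end Algebra

section Split

variable {d ℓ : ℕ} {hd : 1 ≤ d + 1} {hL : Odd (ℓ + 1) ∧ 1 < ℓ + 1} {b₀ b₁ : ℝ}
variable {𝔸 : Type} [NormedRing 𝔸] [NormedAlgebra ℂ 𝔸] [CompleteSpace 𝔸]
variable (i : KIdx d ℓ hd hL b₀ b₁) (q : ↥(cubes (toKT i).D.toDomains))

/-- ★ **`V(A) = Δ_{a,□}(U₀) − Δ_{a,□}(U′)` SPLIT BY LETTER**: the Laplacian piece `Δ(U₀) − Δ(U′)` (print's `V₁`∕`V₃` locus, (3.70)–(3.73)), the projection piece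
`D_{U₀}R_□(U₀)D*_{U₀} − D_{U′}R_□(U′)D*_{U′}` ((3.74)–(3.77): `V₂ + P₁`), the averaging piece `Q*_□(U₀)aQ_□(U₀) − Q*_□(U′)aQ_□(U′)` ((3.80)–(3.83): `P₂`) — for r05's
`deltaACubeY` (:156), any transporter letters, any two backgrounds. [cite: Balaban1985BackgroundPropagators, (3.82) p.407, (3.26) p.395] -/
theorem deltaACubeY_sub_split (parS : SiteParY 𝔸 i) (parB : BondParY 𝔸 i) (U₀ U' : CfgY 𝔸 i) :
    deltaACubeY i q parS parB U₀ - deltaACubeY i q parS parB U' =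
      (hessY i U₀ - hessY i U') +
      (gradY i U₀ ∘ₗ RCubeY i q parS U₀ ∘ₗ divY i U₀ - gradY i U' ∘ₗ RCubeY i q parS U' ∘ₗ divY i U') +
      (QsCubeY i q parB U₀ ∘ₗ aCubeY i q ∘ₗ QCubeY i q parB U₀ - QsCubeY i q parB U' ∘ₗ aCubeY i q ∘ₗ QCubeY i q parB U') := by
  simp only [deltaACubeY]; abel

/-- **THE PROJECTION PIECE REGROUPED AS IN (3.74)–(3.76)**: `D₀R₀D₀* − D′R′D′* = (D₀ − D′)R₀D₀* + D′(R₀ − R′)D₀* + D′R′(D₀* − D′*)` — the two outer terms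
are print's first-order `V₂`-type pieces (transporter differences next to one derivative), the middle one is `P₁(A)` («a non-local bounded operator»).
[cite: Balaban1985BackgroundPropagators, (3.74)–(3.77) p.405] -/
theorem gradRdiv_sub_regroup (parS : SiteParY 𝔸 i) (U₀ U' : CfgY 𝔸 i) :
    gradY i U₀ ∘ₗ RCubeY i q parS U₀ ∘ₗ divY i U₀ - gradY i U' ∘ₗ RCubeY i q parS U' ∘ₗ divY i U' =
      (gradY i U₀ - gradY i U') ∘ₗ RCubeY i q parS U₀ ∘ₗ divY i U₀ +
      gradY i U' ∘ₗ (RCubeY i q parS U₀ - RCubeY i q parS U') ∘ₗ divY i U₀ +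
      gradY i U' ∘ₗ RCubeY i q parS U' ∘ₗ (divY i U₀ - divY i U') :=
  comp3_sub_comp3 _ _ _ _ _ _

/-- **THE AVERAGING PIECE REGROUPED AS IN (3.82)** with the LETTERS `F₂ := Q_□(U′) − Q_□(U₀)`, `F₂* := Q*_□(U′) − Q*_□(U₀)` ((3.80): «Q(U′U) = Q(U) + F₂(A),
Q*(U′U) = Q*(U) + F₂*(A)»): `Q*_□(U′)aQ_□(U′) − Q*_□(U₀)aQ_□(U₀) = F₂*aQ_□(U₀) + Q*_□(U₀)aF₂ + F₂*aF₂` — print's three terms verbatim; nothing of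
(3.80)–(3.81) (the size of `F₂`) is used or claimed. [cite: Balaban1985BackgroundPropagators, (3.82) p.407, (3.80) pp.406–407] -/
theorem QsaQ_sub_regroup (parB : BondParY 𝔸 i) (U₀ U' : CfgY 𝔸 i) :
    QsCubeY i q parB U' ∘ₗ aCubeY i q ∘ₗ QCubeY i q parB U' - QsCubeY i q parB U₀ ∘ₗ aCubeY i q ∘ₗ QCubeY i q parB U₀ =
      (QsCubeY i q parB U' - QsCubeY i q parB U₀) ∘ₗ aCubeY i q ∘ₗ QCubeY i q parB U₀ +
      QsCubeY i q parB U₀ ∘ₗ aCubeY i q ∘ₗ (QCubeY i q parB U' - QCubeY i q parB U₀) +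
      (QsCubeY i q parB U' - QsCubeY i q parB U₀) ∘ₗ aCubeY i q ∘ₗ (QCubeY i q parB U' - QCubeY i q parB U₀) :=
  comp3_sub_comp3' _ _ _ _ _

end Split

/-! ## §2 `L²` composition calculus in the trace currency -/

section Compose

variable {X Y Z : Type} [Fintype X] [Fintype Y] [Fintype Z] {N : ℕ} {wX : X → ℝ} {wY : Y → ℝ} {wZ : Z → ℝ}

/-- **PRODUCTS OF BOUNDED LETTERS**: `‖A(Bx)‖ ≦ α‖Bx‖ ≦ αβ‖x‖` (`α ≧ 0`) — the bookkeeping of «It is a non-local bounded operator» ∕ «F₂*(A)aF₂(A)».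
[cite: Balaban1985BackgroundPropagators, (3.77) p.405, (3.82)–(3.83) p.407; folklore] -/
theorem normBound_comp {A : (Y → Matrix (Fin N) (Fin N) ℂ) →ₗ[ℂ] (Z → Matrix (Fin N) (Fin N) ℂ)}
    {B : (X → Matrix (Fin N) (Fin N) ℂ) →ₗ[ℂ] (Y → Matrix (Fin N) (Fin N) ℂ)} {α β : ℝ} (hα : 0 ≤ α)
    (hA : ∀ y, Real.sqrt (trIP wZ (A y) (A y)) ≤ α * Real.sqrt (trIP wY y y))
    (hB : ∀ x, Real.sqrt (trIP wY (B x) (B x)) ≤ β * Real.sqrt (trIP wX x x)) (x : X → Matrix (Fin N) (Fin N) ℂ) :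
    Real.sqrt (trIP wZ (A (B x)) (A (B x))) ≤ α * β * Real.sqrt (trIP wX x x) := by
  calc Real.sqrt (trIP wZ (A (B x)) (A (B x))) ≤ α * Real.sqrt (trIP wY (B x) (B x)) := hA (B x)
    _ ≤ α * (β * Real.sqrt (trIP wX x x)) := mul_le_mul_of_nonneg_left (hB x) hα
    _ = α * β * Real.sqrt (trIP wX x x) := by ring

/-- **A BOUNDED LETTER AFTER A FIRST-ORDER PIECE STAYS FIRST ORDER**: `‖Bx‖ ≦ a‖x‖ + b‖x‖_E` and `‖Ay‖ ≦ α‖y‖` (`α ≧ 0`) give `‖A(Bx)‖ ≦ αa‖x‖ + αb‖x‖_E`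
(the energy seminorm `‖x‖_E = ⟨x, T₀x⟩^{1/2}` is carried as a parameter `E x`). [cite: Balaban1985BackgroundPropagators, (3.73)–(3.76) pp.404–405; folklore] -/
theorem normBound_comp_firstOrder {A : (Y → Matrix (Fin N) (Fin N) ℂ) →ₗ[ℂ] (Z → Matrix (Fin N) (Fin N) ℂ)}
    {B : (X → Matrix (Fin N) (Fin N) ℂ) →ₗ[ℂ] (Y → Matrix (Fin N) (Fin N) ℂ)} {α a b : ℝ} {E : (X → Matrix (Fin N) (Fin N) ℂ) → ℝ} (hα : 0 ≤ α)
    (hA : ∀ y, Real.sqrt (trIP wZ (A y) (A y)) ≤ α * Real.sqrt (trIP wY y y))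
    (hB : ∀ x, Real.sqrt (trIP wY (B x) (B x)) ≤ a * Real.sqrt (trIP wX x x) + b * E x) (x : X → Matrix (Fin N) (Fin N) ℂ) :
    Real.sqrt (trIP wZ (A (B x)) (A (B x))) ≤ α * a * Real.sqrt (trIP wX x x) + α * b * E x := by
  calc Real.sqrt (trIP wZ (A (B x)) (A (B x))) ≤ α * Real.sqrt (trIP wY (B x) (B x)) := hA (B x)
    _ ≤ α * (a * Real.sqrt (trIP wX x x) + b * E x) := mul_le_mul_of_nonneg_left (hB x) hα
    _ = α * a * Real.sqrt (trIP wX x x) + α * b * E x := by ring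

/-- the trace norm is invariant under negation. [cite: Balaban1985BackgroundPropagators, p.393 (scalar products); bookkeeping] -/
theorem trIP_neg_neg (w : Z → ℝ) (Φ : Z → Matrix (Fin N) (Fin N) ℂ) : trIP w (-Φ) (-Φ) = trIP w Φ Φ := by
  simp [trIP]

/-- the trace norm of a three-term sum. [cite: Balaban1985BackgroundPropagators, (3.82) p.407 («a sum of three terms»); folklore] -/
theorem sqrt_trIP_add3_self_le (hw : ∀ z, 0 < wZ z) (Φ₁ Φ₂ Φ₃ : Z → Matrix (Fin N) (Fin N) ℂ) :
    Real.sqrt (trIP wZ (Φ₁ + Φ₂ + Φ₃) (Φ₁ + Φ₂ + Φ₃)) ≤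
      Real.sqrt (trIP wZ Φ₁ Φ₁) + Real.sqrt (trIP wZ Φ₂ Φ₂) + Real.sqrt (trIP wZ Φ₃ Φ₃) :=
  le_trans (sqrt_trIP_add_self_le hw _ _) (by linarith [sqrt_trIP_add_self_le hw Φ₁ Φ₂])

end Compose

/-! ## §2b The (3.85) mechanism proper: a relative bound against an ARBITRARY seminorm `𝒩` and the mapping property `𝒩(G₀B) ≦ ν‖B‖` of the base inverse -/

section SeminormEngine

variable {S : Type} [Fintype S] {N : ℕ} {w : S → ℝ}
  {T₀ R G₀ : (S → Matrix (Fin N) (Fin N) ℂ) →ₗ[ℂ] (S → Matrix (Fin N) (Fin N) ℂ)} {m a b ν : ℝ} {𝒩 : (S → Matrix (Fin N) (Fin N) ℂ) → ℝ}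

/-- ★★ **«Using the bounds (3.73), (3.77), (3.83) and assuming that Theorem 3.3 holds for G(U), we get … V(A)G(U) is a small operator» — THE MECHANISM IN `L²`
WITH THE DERIVATIVE CONTROL TAKEN FROM `G(U)`, NOT FROM THE ENERGY**: if `T₀` is coercive (`m⟨C,C⟩ ≦ ⟨C,T₀C⟩`, so `‖G₀B‖ ≦ ‖B‖∕m` for a right inverse
`G₀`), `R` has the relative bound `|⟨B, RC⟩| ≦ ‖B‖(a‖C‖ + b·𝒩(C))` against an ARBITRARY functional `𝒩` (print: the first-order part of `V₃` against `|∇_U(·)|`),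
and the base inverse maps into `𝒩` with `𝒩(G₀B) ≦ ν‖B‖` (print: (3.42)₂ ∕ (3.46)₂ for `G(U)` — «assuming that Theorem 3.3 holds for G(U)»), then
`⟨B, R(G₀B)⟩ ≦ (a∕m + bν)·⟨B, B⟩`. [cite: Balaban1985BackgroundPropagators, (3.85)–(3.86) p.407, Thm 3.3 p.399 ((3.42)₂, (3.46)₂)] -/
theorem trIP_comp_rightInv_le_of_relBoundN (hw : ∀ s, 0 < w s) (hm : 0 < m) (ha : 0 ≤ a) (hb : 0 ≤ b)
    (hco : ∀ Φ, m * trIP w Φ Φ ≤ trIP w Φ (T₀ Φ)) (hG₀ : ∀ Ψ, T₀ (G₀ Ψ) = Ψ)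
    (hrel : ∀ Φ Ψ, |trIP w Φ (R Ψ)| ≤ Real.sqrt (trIP w Φ Φ) * (a * Real.sqrt (trIP w Ψ Ψ) + b * 𝒩 Ψ))
    (hN : ∀ Ψ, 𝒩 (G₀ Ψ) ≤ ν * Real.sqrt (trIP w Ψ Ψ)) (Ψ : S → Matrix (Fin N) (Fin N) ℂ) :
    trIP w Ψ (R (G₀ Ψ)) ≤ (a / m + b * ν) * trIP w Ψ Ψ := by
  set p := trIP w Ψ Ψ
  have hp : 0 ≤ p := trIP_self_nonneg w hw Ψ
  have hpp : Real.sqrt p * Real.sqrt p = p := Real.mul_self_sqrt hp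
  -- `‖G₀Ψ‖ ≦ ‖Ψ‖ ∕ m` from the coercivity of `T₀` (n06-w1's `trIP_self_le_of_coercive` at `Φ := G₀Ψ`)
  have h1 : m ^ 2 * trIP w (G₀ Ψ) (G₀ Ψ) ≤ trIP w (T₀ (G₀ Ψ)) (T₀ (G₀ Ψ)) := trIP_self_le_of_coercive hw hm hco (G₀ Ψ)
  rw [hG₀] at h1
  have hq : 0 ≤ trIP w (G₀ Ψ) (G₀ Ψ) := trIP_self_nonneg w hw _
  have h2 : trIP w (G₀ Ψ) (G₀ Ψ) ≤ p / m ^ 2 := by rw [le_div_iff₀ (pow_pos hm 2)]; linarith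
  have hsq : Real.sqrt (trIP w (G₀ Ψ) (G₀ Ψ)) ≤ Real.sqrt p / m := by
    rw [← Real.sqrt_sq hm.le, ← Real.sqrt_div hp]; exact Real.sqrt_le_sqrt h2
  calc trIP w Ψ (R (G₀ Ψ)) ≤ |trIP w Ψ (R (G₀ Ψ))| := le_abs_self _
    _ ≤ Real.sqrt p * (a * Real.sqrt (trIP w (G₀ Ψ) (G₀ Ψ)) + b * 𝒩 (G₀ Ψ)) := hrel Ψ (G₀ Ψ)
    _ ≤ Real.sqrt p * (a * (Real.sqrt p / m) + b * (ν * Real.sqrt p)) := by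
        refine mul_le_mul_of_nonneg_left ?_ (Real.sqrt_nonneg _)
        exact add_le_add (mul_le_mul_of_nonneg_left hsq ha) (mul_le_mul_of_nonneg_left (hN Ψ) hb)
    _ = (a / m + b * ν) * (Real.sqrt p * Real.sqrt p) := by ring
    _ = (a / m + b * ν) * p := by rw [hpp]

/-- the strict form for `a∕m + bν < 1` and `B ≠ 0`: `⟨B, R(G₀B)⟩ < ⟨B, B⟩`. [cite: Balaban1985BackgroundPropagators, (3.85)–(3.86) p.407, Thm 3.11 p.416] -/
theorem trIP_comp_rightInv_lt_self_of_relBoundN (hw : ∀ s, 0 < w s) (hm : 0 < m) (ha : 0 ≤ a) (hb : 0 ≤ b)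
    (hco : ∀ Φ, m * trIP w Φ Φ ≤ trIP w Φ (T₀ Φ)) (hG₀ : ∀ Ψ, T₀ (G₀ Ψ) = Ψ)
    (hrel : ∀ Φ Ψ, |trIP w Φ (R Ψ)| ≤ Real.sqrt (trIP w Φ Φ) * (a * Real.sqrt (trIP w Ψ Ψ) + b * 𝒩 Ψ))
    (hN : ∀ Ψ, 𝒩 (G₀ Ψ) ≤ ν * Real.sqrt (trIP w Ψ Ψ)) (hθ : a / m + b * ν < 1) {Ψ : S → Matrix (Fin N) (Fin N) ℂ} (hΨ : Ψ ≠ 0) :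
    trIP w Ψ (R (G₀ Ψ)) < trIP w Ψ Ψ := by
  have h := trIP_comp_rightInv_le_of_relBoundN hw hm ha hb hco hG₀ hrel hN Ψ
  have hpos := trIP_self_pos w hw hΨ
  nlinarith

end SeminormEngine

/-! ## §3 At the cube letters: (ii) and Theorem 3.11 ∕ (3.84)–(3.86) from three piece bounds -/

section Pieces

open scoped Matrix.Norms.L2Operator

variable {d ℓ : ℕ} {hd : 1 ≤ d + 1} {hL : Odd (ℓ + 1) ∧ 1 < ℓ + 1} {b₀ b₁ : ℝ} {N : ℕ}
variable (i : KIdx d ℓ hd hL b₀ b₁) (q : ↥(cubes (toKT i).D.toDomains))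

/-- ★★ **INPUT (ii) OF `B9Thm311CubeLettersGCoercive` FROM THREE PIECE BOUNDS**: `L²` bounds of first-order shape `‖V_k C‖ ≦ a_k‖C‖ + b_k⟨C, Δ_{a,□}(U₀)C⟩^{1/2}`
for the Laplacian, projection and averaging pieces give the relative bound of `V(A) = Δ_{a,□}(U₀) − Δ_{a,□}(U′)` with constants `(a₁ + a₂ + a₃, b₁ + b₂ + b₃)`.
[cite: Balaban1985BackgroundPropagators, (3.82)–(3.85) p.407, (3.73) p.404, (3.77) p.405, (3.83) p.407] -/
theorem relBound_V_of_pieces (parS : SiteParY (Matrix (Fin N) (Fin N) ℂ) i) (parB : BondParY (Matrix (Fin N) (Fin N) ℂ) i)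
    (U₀ U' : CfgY (Matrix (Fin N) (Fin N) ℂ) i) {a₁ b₁ a₂ b₂ a₃ b₃ : ℝ}
    (hH : ∀ C, Real.sqrt (trIP (fun _ => (1 : ℝ)) ((hessY i U₀ - hessY i U') C) ((hessY i U₀ - hessY i U') C)) ≤
      a₁ * Real.sqrt (trIP (fun _ => (1 : ℝ)) C C) + b₁ * Real.sqrt (trIP (fun _ => (1 : ℝ)) C (deltaACubeY i q parS parB U₀ C)))
    (hR : ∀ C, Real.sqrt (trIP (fun _ => (1 : ℝ))
        ((gradY i U₀ ∘ₗ RCubeY i q parS U₀ ∘ₗ divY i U₀ - gradY i U' ∘ₗ RCubeY i q parS U' ∘ₗ divY i U') C)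
        ((gradY i U₀ ∘ₗ RCubeY i q parS U₀ ∘ₗ divY i U₀ - gradY i U' ∘ₗ RCubeY i q parS U' ∘ₗ divY i U') C)) ≤
      a₂ * Real.sqrt (trIP (fun _ => (1 : ℝ)) C C) + b₂ * Real.sqrt (trIP (fun _ => (1 : ℝ)) C (deltaACubeY i q parS parB U₀ C)))
    (hQ : ∀ C, Real.sqrt (trIP (fun _ => (1 : ℝ))
        ((QsCubeY i q parB U₀ ∘ₗ aCubeY i q ∘ₗ QCubeY i q parB U₀ - QsCubeY i q parB U' ∘ₗ aCubeY i q ∘ₗ QCubeY i q parB U') C)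
        ((QsCubeY i q parB U₀ ∘ₗ aCubeY i q ∘ₗ QCubeY i q parB U₀ - QsCubeY i q parB U' ∘ₗ aCubeY i q ∘ₗ QCubeY i q parB U') C)) ≤
      a₃ * Real.sqrt (trIP (fun _ => (1 : ℝ)) C C) + b₃ * Real.sqrt (trIP (fun _ => (1 : ℝ)) C (deltaACubeY i q parS parB U₀ C)))
    (B C : FBondY i → Matrix (Fin N) (Fin N) ℂ) :
    |trIP (fun _ => (1 : ℝ)) B ((deltaACubeY i q parS parB U₀ - deltaACubeY i q parS parB U') C)| ≤
      Real.sqrt (trIP (fun _ => (1 : ℝ)) B B) * ((a₁ + a₂ + a₃) * Real.sqrt (trIP (fun _ => (1 : ℝ)) C C) +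
        (b₁ + b₂ + b₃) * Real.sqrt (trIP (fun _ => (1 : ℝ)) C (deltaACubeY i q parS parB U₀ C))) := by
  have hw : ∀ _ : FBondY i, (0 : ℝ) < 1 := fun _ => one_pos
  rw [deltaACubeY_sub_split]
  refine relBound_of_normBound hw (fun C => ?_) B C
  exact normBound_add hw (normBound_add hw hH hR) hQ C

/-- **HAND-OVER SHAPE FOR THE AVERAGING PIECE** (coordination with r05's `B9Eq383CubeLetters` §4): a plain `L²` bound `‖P C‖ ≦ a_P‖C‖` for print's
`P₂`-difference written `U′`-FIRST, `P = Q*_□(U′)a_□Q_□(U′) − Q*_□(U₀)a_□Q_□(U₀)`, is the `hQ` input of `relBound_V_of_pieces` ∕ `deltaACubeY_posDefTr_of_pieces` with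
`(a₃, b₃) = (a_P, 0)` (the piece there is `−P`; the trace norm ignores the sign). [cite: Balaban1985BackgroundPropagators, (3.82)–(3.83) p.407] -/
theorem hQ_of_normBound_reversed (parS : SiteParY (Matrix (Fin N) (Fin N) ℂ) i) (parB : BondParY (Matrix (Fin N) (Fin N) ℂ) i)
    (U₀ U' : CfgY (Matrix (Fin N) (Fin N) ℂ) i) {aP : ℝ}
    (hP : ∀ C, Real.sqrt (trIP (fun _ => (1 : ℝ))
        ((QsCubeY i q parB U' ∘ₗ aCubeY i q ∘ₗ QCubeY i q parB U' - QsCubeY i q parB U₀ ∘ₗ aCubeY i q ∘ₗ QCubeY i q parB U₀) C)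
        ((QsCubeY i q parB U' ∘ₗ aCubeY i q ∘ₗ QCubeY i q parB U' - QsCubeY i q parB U₀ ∘ₗ aCubeY i q ∘ₗ QCubeY i q parB U₀) C)) ≤
      aP * Real.sqrt (trIP (fun _ => (1 : ℝ)) C C)) (C : FBondY i → Matrix (Fin N) (Fin N) ℂ) :
    Real.sqrt (trIP (fun _ => (1 : ℝ))
        ((QsCubeY i q parB U₀ ∘ₗ aCubeY i q ∘ₗ QCubeY i q parB U₀ - QsCubeY i q parB U' ∘ₗ aCubeY i q ∘ₗ QCubeY i q parB U') C)
        ((QsCubeY i q parB U₀ ∘ₗ aCubeY i q ∘ₗ QCubeY i q parB U₀ - QsCubeY i q parB U' ∘ₗ aCubeY i q ∘ₗ QCubeY i q parB U') C)) ≤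
      aP * Real.sqrt (trIP (fun _ => (1 : ℝ)) C C) + 0 * Real.sqrt (trIP (fun _ => (1 : ℝ)) C (deltaACubeY i q parS parB U₀ C)) := by
  have hneg : (QsCubeY i q parB U₀ ∘ₗ aCubeY i q ∘ₗ QCubeY i q parB U₀ - QsCubeY i q parB U' ∘ₗ aCubeY i q ∘ₗ QCubeY i q parB U') C =
      -((QsCubeY i q parB U' ∘ₗ aCubeY i q ∘ₗ QCubeY i q parB U' - QsCubeY i q parB U₀ ∘ₗ aCubeY i q ∘ₗ QCubeY i q parB U₀) C) := by
    rw [← LinearMap.neg_apply, neg_sub]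
  rw [hneg, trIP_neg_neg, zero_mul, add_zero]
  exact hP C

/-- ★★★ **THEOREM 3.11 ∕ (3.84)–(3.86) FOR THE CUBE LETTERS FROM (i) + THREE PIECE BOUNDS**: with a coercivity `m⟨C,C⟩ ≦ ⟨C, Δ_{a,□}(U₀)C⟩` and piece bounds
`(a_k, b_k)`, `θ := (a₁+a₂+a₃)∕m + (b₁+b₂+b₃)∕√m < 1`: `Δ_{a,□}(U′)` is positive definite and invertible, `G_□(U′) > 0`, `(1 − θ)m⟨B, G_□(U′)B⟩ ≦ ⟨B,B⟩`,
`((1 − θ)m)²‖G_□(U′)B‖² ≦ ‖B‖²` (`B9Thm311CubeLettersGCoercive.deltaACubeY_posDefTr_of_relBound` with (ii) from `relBound_V_of_pieces`).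
[cite: Balaban1985BackgroundPropagators, Thm 3.11 p.416, (3.82)–(3.86) p.407, (3.27) p.395, p.409 l.3–5] -/
theorem deltaACubeY_posDefTr_of_pieces (parS : SiteParY (Matrix (Fin N) (Fin N) ℂ) i) (parB : BondParY (Matrix (Fin N) (Fin N) ℂ) i)
    (U₀ U' : CfgY (Matrix (Fin N) (Fin N) ℂ) i) {m a₁ b₁ a₂ b₂ a₃ b₃ : ℝ} (hm : 0 < m)
    (ha₁ : 0 ≤ a₁) (hb₁ : 0 ≤ b₁) (ha₂ : 0 ≤ a₂) (hb₂ : 0 ≤ b₂) (ha₃ : 0 ≤ a₃) (hb₃ : 0 ≤ b₃)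
    (hco : ∀ C, m * trIP (fun _ => (1 : ℝ)) C C ≤ trIP (fun _ => (1 : ℝ)) C (deltaACubeY i q parS parB U₀ C))
    (hH : ∀ C, Real.sqrt (trIP (fun _ => (1 : ℝ)) ((hessY i U₀ - hessY i U') C) ((hessY i U₀ - hessY i U') C)) ≤
      a₁ * Real.sqrt (trIP (fun _ => (1 : ℝ)) C C) + b₁ * Real.sqrt (trIP (fun _ => (1 : ℝ)) C (deltaACubeY i q parS parB U₀ C)))
    (hR : ∀ C, Real.sqrt (trIP (fun _ => (1 : ℝ))
        ((gradY i U₀ ∘ₗ RCubeY i q parS U₀ ∘ₗ divY i U₀ - gradY i U' ∘ₗ RCubeY i q parS U' ∘ₗ divY i U') C)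
        ((gradY i U₀ ∘ₗ RCubeY i q parS U₀ ∘ₗ divY i U₀ - gradY i U' ∘ₗ RCubeY i q parS U' ∘ₗ divY i U') C)) ≤
      a₂ * Real.sqrt (trIP (fun _ => (1 : ℝ)) C C) + b₂ * Real.sqrt (trIP (fun _ => (1 : ℝ)) C (deltaACubeY i q parS parB U₀ C)))
    (hQ : ∀ C, Real.sqrt (trIP (fun _ => (1 : ℝ))
        ((QsCubeY i q parB U₀ ∘ₗ aCubeY i q ∘ₗ QCubeY i q parB U₀ - QsCubeY i q parB U' ∘ₗ aCubeY i q ∘ₗ QCubeY i q parB U') C)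
        ((QsCubeY i q parB U₀ ∘ₗ aCubeY i q ∘ₗ QCubeY i q parB U₀ - QsCubeY i q parB U' ∘ₗ aCubeY i q ∘ₗ QCubeY i q parB U') C)) ≤
      a₃ * Real.sqrt (trIP (fun _ => (1 : ℝ)) C C) + b₃ * Real.sqrt (trIP (fun _ => (1 : ℝ)) C (deltaACubeY i q parS parB U₀ C)))
    (hθ : (a₁ + a₂ + a₃) / m + (b₁ + b₂ + b₃) / Real.sqrt m < 1) :
    PosDefTr (fun _ => (1 : ℝ)) (deltaACubeY i q parS parB U') ∧ IsUnit (deltaACubeY i q parS parB U') ∧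
      PosDefTr (fun _ => (1 : ℝ)) (GACubeY i q parS parB U') ∧
      (∀ B : FBondY i → Matrix (Fin N) (Fin N) ℂ,
        ((1 - ((a₁ + a₂ + a₃) / m + (b₁ + b₂ + b₃) / Real.sqrt m)) * m) * trIP (fun _ => (1 : ℝ)) B (GACubeY i q parS parB U' B) ≤
          trIP (fun _ => (1 : ℝ)) B B) ∧
      (∀ B : FBondY i → Matrix (Fin N) (Fin N) ℂ,
        ((1 - ((a₁ + a₂ + a₃) / m + (b₁ + b₂ + b₃) / Real.sqrt m)) * m) ^ 2 *
            trIP (fun _ => (1 : ℝ)) (GACubeY i q parS parB U' B) (GACubeY i q parS parB U' B) ≤ trIP (fun _ => (1 : ℝ)) B B) :=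
  deltaACubeY_posDefTr_of_relBound i q parS parB U₀ U' hm (by positivity) (by positivity) hco
    (relBound_V_of_pieces i q parS parB U₀ U' hH hR hQ) hθ

/-- ★★ **r05's `hV` FROM (i) + THREE PIECE BOUNDS** at the `U = 1` base with def-Y's v4 transporters (`0 < b₀`): `⟨B, V(A)G_□(1)B⟩ < ⟨B, B⟩` for `B ≠ 0`
(`B9Thm311CubeLettersGCoercive.hV_of_relBound` with (ii) from `relBound_V_of_pieces`). [cite: Balaban1985BackgroundPropagators, (3.82)–(3.86) p.407, Thm 3.11 p.416] -/
theorem hV_of_pieces (hb₀ : 0 < b₀) (U' : CfgY (Matrix (Fin N) (Fin N) ℂ) i) {m a₁ b₁ a₂ b₂ a₃ b₃ : ℝ} (hm : 0 < m)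
    (ha₁ : 0 ≤ a₁) (hb₁ : 0 ≤ b₁) (ha₂ : 0 ≤ a₂) (hb₂ : 0 ≤ b₂) (ha₃ : 0 ≤ a₃) (hb₃ : 0 ≤ b₃)
    (hco : ∀ C, m * trIP (fun _ => (1 : ℝ)) C C ≤
      trIP (fun _ => (1 : ℝ)) C (deltaACubeY i q (parSymY i) (parBY i) (fun _ _ => 1 : CfgY (Matrix (Fin N) (Fin N) ℂ) i) C))
    (hH : ∀ C, Real.sqrt (trIP (fun _ => (1 : ℝ))
        ((hessY i (fun _ _ => 1 : CfgY (Matrix (Fin N) (Fin N) ℂ) i) - hessY i U') C)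
        ((hessY i (fun _ _ => 1 : CfgY (Matrix (Fin N) (Fin N) ℂ) i) - hessY i U') C)) ≤
      a₁ * Real.sqrt (trIP (fun _ => (1 : ℝ)) C C) +
        b₁ * Real.sqrt (trIP (fun _ => (1 : ℝ)) C (deltaACubeY i q (parSymY i) (parBY i) (fun _ _ => 1 : CfgY (Matrix (Fin N) (Fin N) ℂ) i) C)))
    (hR : ∀ C, Real.sqrt (trIP (fun _ => (1 : ℝ))
        ((gradY i (fun _ _ => 1 : CfgY (Matrix (Fin N) (Fin N) ℂ) i) ∘ₗ
              RCubeY i q (parSymY i) (fun _ _ => 1 : CfgY (Matrix (Fin N) (Fin N) ℂ) i) ∘ₗ divY i (fun _ _ => 1 : CfgY (Matrix (Fin N) (Fin N) ℂ) i) -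
            gradY i U' ∘ₗ RCubeY i q (parSymY i) U' ∘ₗ divY i U') C)
        ((gradY i (fun _ _ => 1 : CfgY (Matrix (Fin N) (Fin N) ℂ) i) ∘ₗ
              RCubeY i q (parSymY i) (fun _ _ => 1 : CfgY (Matrix (Fin N) (Fin N) ℂ) i) ∘ₗ divY i (fun _ _ => 1 : CfgY (Matrix (Fin N) (Fin N) ℂ) i) -
            gradY i U' ∘ₗ RCubeY i q (parSymY i) U' ∘ₗ divY i U') C)) ≤
      a₂ * Real.sqrt (trIP (fun _ => (1 : ℝ)) C C) +
        b₂ * Real.sqrt (trIP (fun _ => (1 : ℝ)) C (deltaACubeY i q (parSymY i) (parBY i) (fun _ _ => 1 : CfgY (Matrix (Fin N) (Fin N) ℂ) i) C)))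
    (hQ : ∀ C, Real.sqrt (trIP (fun _ => (1 : ℝ))
        ((QsCubeY i q (parBY i) (fun _ _ => 1 : CfgY (Matrix (Fin N) (Fin N) ℂ) i) ∘ₗ aCubeY i q ∘ₗ
              QCubeY i q (parBY i) (fun _ _ => 1 : CfgY (Matrix (Fin N) (Fin N) ℂ) i) -
            QsCubeY i q (parBY i) U' ∘ₗ aCubeY i q ∘ₗ QCubeY i q (parBY i) U') C)
        ((QsCubeY i q (parBY i) (fun _ _ => 1 : CfgY (Matrix (Fin N) (Fin N) ℂ) i) ∘ₗ aCubeY i q ∘ₗ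
              QCubeY i q (parBY i) (fun _ _ => 1 : CfgY (Matrix (Fin N) (Fin N) ℂ) i) -
            QsCubeY i q (parBY i) U' ∘ₗ aCubeY i q ∘ₗ QCubeY i q (parBY i) U') C)) ≤
      a₃ * Real.sqrt (trIP (fun _ => (1 : ℝ)) C C) +
        b₃ * Real.sqrt (trIP (fun _ => (1 : ℝ)) C (deltaACubeY i q (parSymY i) (parBY i) (fun _ _ => 1 : CfgY (Matrix (Fin N) (Fin N) ℂ) i) C)))
    (hθ : (a₁ + a₂ + a₃) / m + (b₁ + b₂ + b₃) / Real.sqrt m < 1) (B : FBondY i → Matrix (Fin N) (Fin N) ℂ) (hB : B ≠ 0) :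
    trIP (fun _ => (1 : ℝ)) B
        ((deltaACubeY i q (parSymY i) (parBY i) (fun _ _ => 1 : CfgY (Matrix (Fin N) (Fin N) ℂ) i) - deltaACubeY i q (parSymY i) (parBY i) U')
          (GACubeY i q (parSymY i) (parBY i) (fun _ _ => 1 : CfgY (Matrix (Fin N) (Fin N) ℂ) i) B)) <
      trIP (fun _ => (1 : ℝ)) B B :=
  hV_of_relBound i q hb₀ U' hm (by positivity) (by positivity) hco (relBound_V_of_pieces i q (parSymY i) (parBY i) _ U' hH hR hQ) hθ B hB

/-- ★★★ **r05's `hV` BY PRINT's OWN (3.85) MECHANISM**: at the `U = 1` base with def-Y's v4 transporters (`0 < b₀`), from (i) a flat coercivity `m`, (ii′) a relative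
bound of `V(A) = Δ_{a,□}(1) − Δ_{a,□}(U′)` against an ARBITRARY functional `𝒩` (its first-order part: (3.73), (3.74)–(3.75)) and (iii) the mapping property
`𝒩(G_□(1)B) ≦ ν‖B‖` of the FLAT cube inverse («assuming that Theorem 3.3 holds for G(U)» — at `U = 1` this is [4]: (3.42)₂∕(3.46)₂ for `G_□(1)`, in `L²`), with
`a∕m + bν < 1`: `⟨B, V(A)G_□(1)B⟩ < ⟨B, B⟩` for `B ≠ 0` — the `hV` of `B9Thm311CubeLettersG.GACubeY_parSymY_posDefTr_of_smallFieldGauge` VERBATIM.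
[cite: Balaban1985BackgroundPropagators, (3.84)–(3.86) p.407, Thm 3.11 p.416, Thm 3.3 p.399; Balaban1984PropagatorsII, Prop. 2.6 (2.136) p.247, p.228] -/
theorem hV_of_relBoundN (hb₀ : 0 < b₀) (U' : CfgY (Matrix (Fin N) (Fin N) ℂ) i) {m a b ν : ℝ} {𝒩 : (FBondY i → Matrix (Fin N) (Fin N) ℂ) → ℝ}
    (hm : 0 < m) (ha : 0 ≤ a) (hb : 0 ≤ b)
    (hco : ∀ C, m * trIP (fun _ => (1 : ℝ)) C C ≤
      trIP (fun _ => (1 : ℝ)) C (deltaACubeY i q (parSymY i) (parBY i) (fun _ _ => 1 : CfgY (Matrix (Fin N) (Fin N) ℂ) i) C))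
    (hrel : ∀ B C, |trIP (fun _ => (1 : ℝ)) B
        ((deltaACubeY i q (parSymY i) (parBY i) (fun _ _ => 1 : CfgY (Matrix (Fin N) (Fin N) ℂ) i) - deltaACubeY i q (parSymY i) (parBY i) U') C)| ≤
      Real.sqrt (trIP (fun _ => (1 : ℝ)) B B) * (a * Real.sqrt (trIP (fun _ => (1 : ℝ)) C C) + b * 𝒩 C))
    (hN : ∀ B, 𝒩 (GACubeY i q (parSymY i) (parBY i) (fun _ _ => 1 : CfgY (Matrix (Fin N) (Fin N) ℂ) i) B) ≤ ν * Real.sqrt (trIP (fun _ => (1 : ℝ)) B B))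
    (hθ : a / m + b * ν < 1) (B : FBondY i → Matrix (Fin N) (Fin N) ℂ) (hB : B ≠ 0) :
    trIP (fun _ => (1 : ℝ)) B
        ((deltaACubeY i q (parSymY i) (parBY i) (fun _ _ => 1 : CfgY (Matrix (Fin N) (Fin N) ℂ) i) - deltaACubeY i q (parSymY i) (parBY i) U')
          (GACubeY i q (parSymY i) (parBY i) (fun _ _ => 1 : CfgY (Matrix (Fin N) (Fin N) ℂ) i) B)) <
      trIP (fun _ => (1 : ℝ)) B B := by
  have h1 := deltaACubeY_one_mul_GACubeY_one i q hb₀ (fun z w => parSymY_one (𝔸 := Matrix (Fin N) (Fin N) ℂ) i z w)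
    (fun s s' => parBY_one (𝔸 := Matrix (Fin N) (Fin N) ℂ) i s s')
  have hG₀ : ∀ Ψ, deltaACubeY i q (parSymY i) (parBY i) (fun _ _ => 1 : CfgY (Matrix (Fin N) (Fin N) ℂ) i)
      (GACubeY i q (parSymY i) (parBY i) (fun _ _ => 1 : CfgY (Matrix (Fin N) (Fin N) ℂ) i) Ψ) = Ψ := fun Ψ => (LinearMap.ext_iff.mp h1) Ψ
  exact trIP_comp_rightInv_lt_self_of_relBoundN (fun _ => one_pos) hm ha hb hco hG₀ hrel hN hθ hB

end Pieces

end

end Literature.MathematicalPhysics.QuantumFieldTheory.Balaban1983to89.B9Eq382CubeLetters
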